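import Summits.BirchSwinnertonDyer.BirchSwinnertonDyer.Theorems.KatoDescentPotSupersingularWildUpperMuRoadThreeUnipotentRecords03
import Literature.NumberTheory.EllipticCurves.FineSelmerLimThm35Proofs
import Literature.NumberTheory.EllipticCurves.FineSelmerClassGroupCriterionThm34Proofs
import Literature.NumberTheory.IwasawaTheory.Fukuda1994Thm1Proofs
import Literature.NumberTheory.IwasawaTheory.Fukuda1994Thm1RankProofs
import HarnessLib

/-!
# NoF RE-ISSUE (seat `bsd-potss-k9-c4` g25, 2026-08-29; `--supports stmt-BirchSwinnertonDyer-19197 --as helper`) of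
# `KatoDescentPotSupersingularWildUpperMuRoadThreeUnipotentRecords03.lean`:
# the SAME per-row theorems with the μ-road named facts that are now TREE THEOREMS no longer displayed as hypotheses —
# `hLim` (Lim 2017 Thm. 3.5) := `Lim2017.thm35_fineSelmerDual_moduleFinite_of_classicalMuVanishes_of_le_divisionField_holds` (rkm g34, p695193),
# `hF1` (Fukuda 1994 Thm. 1 (1)) := `IwasawaTheory.fukuda1994_thm1_classNumberPExp_const_of_succ_eq_holds` (k8t-c4 g20),
# `hF2` (Fukuda 1994 Thm. 1 (2)) := `IwasawaTheory.fukuda1994_thm1_classGroupPRank_const_of_succ_eq_holds` (k8t-c4 g20, p681350),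
# `hCS` (Coates–Sujatha 2005 Thm. 3.4) := `CoatesSujatha2005.thm34_fineSelmerDual_moduleFinite_of_classicalMuVanishes_divisionField_holds` (k8t-c4 g22, p694085).

HONEST FRAMING. THEOREMS ONLY; PER ROW; nothing booked; items 19189 / 19197 / 19942 stay OPEN at class level (open input of record: the zeta crux 24327);
(A) / Conjecture A / BSD proved for NO class of curves.  Every theorem below is the original record (same name + suffix `NoF`, same displayed NUMERIC
hypotheses, same kernel certificates, same proof term) with the discharged fact binders deleted and the `_holds` theorems substituted in the proof; the
remaining displayed named facts are exactly those the original displays minus {hLim, hF1, hF2, hCS} (for the `GL₂(𝔽₃)` `L_P`-road records: NONE beyond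
`hKatoA hGZK hmod` on the U₀ twin — statement (A) at `(E,3)` becomes a kernel theorem modulo the displayed numerics of `L_P` alone; for the Cartan
unit-index / Fukuda records: Ferrero–Washington `hFW` only).  Row section headers, numerics, evidence pointers and citations are those of the original
file VERBATIM (its module docstring is reproduced below under «ORIGINAL HEADER»); the per-theorem docstrings are the originals prefixed with the NoF marker.

ORIGINAL HEADER of `KatoDescentPotSupersingularWildUpperMuRoadThreeUnipotentRecords03`:

> # Route `KatoDescentPotSupersingular` (rung K9, sub-rung B5 = O6 wild `p = 3`, cell `bsd-potss`): per-row U₀ RECORDS on the `GL₂(𝔽₃)`-image (9-deficient) U₀-ns rows BY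
> # FUKUDA'S LAYER CRITERION AT `(0,1)` ON THE UNIPOTENT-STABILISER FIELD `L_P = ℚ(E[3])^{U_P} = ℚ(P, ζ₃)` (degree 16) — a SECOND road beside the unit-twist records on rows
> # with NO Cartan road (`3 ∣ #GL₂(𝔽₃)`), part 03: 388800hw1, 388800hx1, 388800ii1, 388800ol1
> # (seat `bsd-potss-k9-c4` g23; door = k9-c4 g19's `UnitIndexMuDoors.missingUpperBoundAt_three_of_classNumberPExp_succ_eqAt_unipotentStabilizerField` (p635084) at `n = 0`;
> # record shape = k9-c4 g21's `…WildConjAResidueUnitIndexRows06` (`_lp12`, 388800ho1) verbatim with `n = 0`; numerics = conjA-anchor g9's kit j296187 (`lp16.gp`);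
> # `--supports stmt-BirchSwinnertonDyer-19197 --as helper`)
> 
> HONEST FRAMING. THEOREMS ONLY (no definition, no named fact, no `sorry`); PER ROW — NOT a class theorem; nothing booked; items 19189 / 19197 (and the aside 19386,
> whose stub `surjModThree` these rows populate) stay OPEN at class level (open non-held input of the U₀ cone: the zeta crux 24327); (A), Conjecture A and BSD are
> proved for NO curve here.  CONDITIONAL on the named facts displayed as hypotheses (Lim 2017 Thm. 3.5 `hLim`, Fukuda 1994 Thm. 1 (1) `hF1`; for U₀ also Kato's
> A161-fine `hKatoA`, GZK `hGZK`, modularity `hmod`) and on two displayed NUMERIC hypotheses about ONE explicit number field per row, `L_P = ℚ(E[3])^{U_P}` for a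
> `3`-torsion point `P` (conjA-anchor g9, `Literature/…/DivisionFieldUnipotentStabilizer.lean`: the image of `U_P` is a `3`-group, so Lim's index hypothesis is
> structural; `L_P = ℚ(P, ζ₃)` by the Weil pairing on the certificate side):
> * `hram` — Fukuda's index is `0` on `L_P`: every prime of `L_P` above `3` is totally ramified in the first cyclotomic layer.  EVIDENCE (kit j296187, EXACT): the
>   ramification indices of the primes above `3` of `k = ℚ(x(P))` are all multiplied by `3` in `k₁ = k·ℚ(ζ₉)⁺` (column TOTRAM), and `[L_P : k] = 4` is prime to `3`;
> * `hord` — `e₁(L_P) = e₀(L_P)`.  EVIDENCE (kit j296187): `e₀(L_P) = ord₃ h(L_P)` from `bnfinit` + `bnfcertify` on the degree-16 field (CERTIFIED on every row below);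
>   `e₁(L_P)` is NOT read off the degree-48 layer but through Kuroda's relation for the `V₄`-extension `L_{P,1}/k₁` (tree theorem
>   `IwasawaTheory.classNumberPExp_biquadratic_relation`, conjA-anchor g11; exact on `3`-parts for odd `p`): `e(L_{P,n}) + 2·e(k_n) = e(O_{1,n}) + e(O_{2,n}) + e(O_{3,n})`
>   over the three octics `O₁ = ℚ(P)`, `O₂ = k(ζ₃)`, `O₃` between `k` and `L_P` (checked at layer 0 on every row: column KURODA-OK), with `h(O_{i,1})` of the three
>   degree-24 layers under GRH — so GRH enters ONLY through `e₁`.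
> Then Fukuda 1994 Thm. 1 (1) (`n₀ = 0`) gives `e_n(L_P) = e₀(L_P)` for all `n`, i.e. `μ(L_P,cyc) = 0` (and `λ = 0`), Lim 2017 Thm. 3.5 + Lemma 3.2 give Conjecture A for
> `E` at `3` over `ℚ_cyc`, and Kato 14.5 (3) / 12.5 (3) (A161-fine) + GZK + modularity give U₀.  KERNEL row certificates (imported): `Δ ≠ 0`, global minimality,
> `E[3]` irreducible (`irr_g…_3`), `ClassO6 E 3` (`classO6_g…_3`).  The `GL₂(𝔽₃)` rows on which `e₁(L_P) > e₀(L_P)` (7776f1, 194400cn1, 388800hd1, 388800ij1, 470448dq1;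
> 388800ho1 = k9-c4 g21 `_lp12`) are NOT recorded here.
> 
> References: [Lim2017FineSelmer] §3 Thm. 3.5, Lemma 3.2; [Fukuda1994] Thm. 1 (1); [Lemmermeyer1994] §1 (Kuroda); [Kato2004Asterisque] Thm. 14.5 (3), 12.5 (3);
> [CoatesSujatha2005] Thm. 3.4; [Serre1972] §IV; [Cremona2006] Table 1.
> 
-/

set_option linter.dupNamespace false
set_option autoImplicit false

noncomputable section

open scoped Classical NumberField
open WeierstrassCurve NumberField IsDedekindDomain Field IntermediateField
  Literature.NumberTheory.EllipticCurves Literature.NumberTheory.EllipticCurves.Rank1Residual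
  Literature.NumberTheory.EllipticCurves.Rank1Residual.Typed
  Literature.NumberTheory.GaloisRepresentations Literature.NumberTheory.SerreUniformity Literature.NumberTheory.IwasawaTheory
  Summit.BirchSwinnertonDyer.Rank1Residual Summit.BirchSwinnertonDyer.Rank1Residual.Additive
  Summit.BirchSwinnertonDyer.BirchSwinnertonDyer.Theorems

namespace Summit.BirchSwinnertonDyer.BirchSwinnertonDyer.Theorems.WildUpperUnitTwistRecords

/-! ### `388800hw1` @ `p = 3` — `N = 388800 = 2^6·3^5·5^2`; Cremona: `r_an = 0`; O6 wild at `3`; mod-`3` image `GL₂(𝔽₃)` (9-deficient tower; NO Cartan road); first road: the unit-twist record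
`missingUpperBoundAt_g388800hw1_3` (k9-c4 g16/g17); kernel lemmas in `…WildUpperUnitTwistRecordsClassO618` (`classO6`) / `…WildUpperUnitTwistRecordsFlat47` (`irr`, `isElliptic`, `isGloballyMinimal`).  conjA-anchor g9 kit j296187
(`lp16.gp`): `k = ℚ(x(P)) = ℚ[x]/(x^4-6*x^2-2*x+6)` (`h = 1`), `K = ℚ(P) = ℚ[x]/(x^8-4*x^7+4*x^6-132*x^5-312*x^3-374*x^2-76*x-566)` (`h = 2`), `L_P = ℚ(P, ζ₃) = ℚ[x]/(x^16-8*x^15+36*x^14-112*x^13+416*x^12-2304*x^11+5484*x^10-5916*x^9+50082*x^8-168416*x^7+115984*x^6-476304*x^5+2558916*x^4-2999112*x^3+2613036*x^2-10123208*x+10719076)` (degree 16): `h(L_P) = 2`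
(`Cl ≅ [2]`, CERTIFIED), primes above `3`: `2[[6,2],[2,2]]`; octic leaves `O1:h=2:CERT;O2:h=2:CERT;O3:h=1:CERT;O1,1:h=2:GRH;O2,1:h=2:GRH;O3,1:h=1:GRH`; `layer0; #octics>k 3 of 3 octic subfields; v3h(L_P)+2v3h(k) 0; sum v3h(O_i) 0; KURODA-OK; octics certified 1; k cert CERT`; layer `(0,1)`: TOTRAM, `e₀(L_P) = 0`, `e₁(L_P) = 0` (Kuroda, GRH),
`r₀ = 0`, `r₁ = 0` ⟹ verdict FUKUDA1-LP(0,1). -/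

/-- **[NoF re-issue: the named facts `hLim`/`hF1`/`hF2`/`hCS` displayed by the original are DISCHARGED here by the tree theorems `…_holds` — read «modulo hLim/hF1/hF2/hCS» below as «no longer assumed».]** **(A) AT `(388800hw1, 3)` with the `μ`-hypothesis DISCHARGED by FUKUDA Thm. 1 (1) at layers `(0,1)` on `L_P = ℚ(E[3])^{U_P}`** (modulo the named facts
Lim 2017 Thm. 3.5 `hLim` and Fukuda `hF1`): `P` any geometric `3`-torsion point, displayed numerics on `L_P`: Fukuda index `0` (`hram`, exact: kit j296187 TOTRAM) and
`e₁(L_P) = e₀(L_P) = 0` (`hord`; `h(L_P) = 2` CERTIFIED, `e₁` by Kuroda from three degree-24 octic layers under GRH, kit j296187). CONDITIONAL; nothing booked;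
(A)/BSD proved for no curve. [cite: Lim2017FineSelmer, §3 Thm. 3.5 and Lemma 3.2 (arXiv:1306.2047 pp. 6–7)] [cite: Fukuda1994, Thm. 1 (1), p. 264] [cite: Cremona2006, Table 1 (Cremona label 388800hw1)] -/
theorem conjA_g388800hw1_3_lp01NoF
    {W : WeierstrassCurve ℚ} [W.IsElliptic] (hWeq : W = (⟨0, 0, 0, (-2700), (-42000)⟩ : WeierstrassCurve ℚ)) (P : W.geomTorsion (3 : ℕ))
    (hram : ∀ κ : ZpExtension ↥(W.unipotentStabilizerField 3 P) 3, κ.IsCyclotomic → TotallyRamifiedFrom κ 0)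
    (hord : ∀ κ : ZpExtension ↥(W.unipotentStabilizerField 3 P) 3, κ.IsCyclotomic →
      classNumberPExp κ (0 + 1) = classNumberPExp κ 0)
    (κ : ZpExtension ℚ 3) (hκ : κ.IsCyclotomic) :
    ∃ (γ : absoluteGaloisGroup ℚ) (Df : W.FineSelmerDualData κ γ),
      Module.Finite ℤ_[3] (RestrictScalars ℤ_[3] (IwasawaAlgebra 3) Df.X) := by
  subst hWeq
  haveI : Fact (Nat.Prime 3) := ⟨Nat.prime_three⟩
  exact Lim2017.fineSelmerDual_moduleFinite_of_classNumberPExp_succ_eq_unipotentStabilizerField fukuda1994_thm1_classNumberPExp_const_of_succ_eq_holds Lim2017.thm35_fineSelmerDual_moduleFinite_of_classicalMuVanishes_of_le_divisionField_holds _ 3 (by decide) 0 P hram hord κ hκ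

/-- **[NoF re-issue: the named facts `hLim`/`hF1`/`hF2`/`hCS` displayed by the original are DISCHARGED here by the tree theorems `…_holds` — read «modulo hLim/hF1/hF2/hCS» below as «no longer assumed».]** **RECORD (second road) — U₀ `ord₃ #Ш(E) ≤ ord₃ #Ш_an(E)` for `E = 388800hw1` with the `μ`-hypothesis DISCHARGED by FUKUDA Thm. 1 (1) at layers `(0,1)` on `L_P`**: named facts
{A161-fine `hKatoA`, GZK `hGZK`, modularity `hmod`, `hLim`, `hF1`}, Cremona's `r_an = 0` (`hr`), a `3`-torsion point `P` and the displayed numerics `hram` / `hord` of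
`L_P = ℚ(E[3])^{U_P}` (evidence: conjA-anchor g9 kit j296187; GRH through the degree-24 octic layers only). KERNEL: `E` elliptic, minimal, `ClassO6 E 3`, `E[3]` irreducible.
Per row; nothing booked; BSD proved for no curve. [cite: Kato2004Asterisque, Thm. 14.5 (3) (p. 236)] [cite: Lim2017FineSelmer, §3 Thm. 3.5 and Lemma 3.2 (arXiv:1306.2047 pp. 6–7)]
[cite: Fukuda1994, Thm. 1 (1), p. 264] [cite: Cremona2006, Table 1 (Cremona label 388800hw1)] -/
theorem missingUpperBoundAt_g388800hw1_3_lp01NoF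
    (hKatoA : Kato2004.rankZero_padicValNat_sha_add_padicValNat_tamagawa_le_of_additive_potGood_of_irreducible_of_fineSelmerDual_fg)
    (hGZK : rank_eq_analyticRank_of_analyticRank_le_one) (hmod : hasEntireLFunction_rat)
    {W : WeierstrassCurve ℚ} [W.IsElliptic] [W.IsGloballyMinimal] (hWeq : W = (⟨0, 0, 0, (-2700), (-42000)⟩ : WeierstrassCurve ℚ))
    (hr : W.analyticRank = 0) (P : W.geomTorsion (3 : ℕ))
    (hram : ∀ κ : ZpExtension ↥(W.unipotentStabilizerField 3 P) 3, κ.IsCyclotomic → TotallyRamifiedFrom κ 0)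
    (hord : ∀ κ : ZpExtension ↥(W.unipotentStabilizerField 3 P) 3, κ.IsCyclotomic →
      classNumberPExp κ (0 + 1) = classNumberPExp κ 0) :
    MissingUpperBoundAt W 3 := by
  subst hWeq
  haveI : Fact (Nat.Prime 3) := ⟨Nat.prime_three⟩
  exact UnitIndexMuDoors.missingUpperBoundAt_three_of_classNumberPExp_succ_eqAt_unipotentStabilizerField _ hKatoA hGZK hmod Lim2017.thm35_fineSelmerDual_moduleFinite_of_classicalMuVanishes_of_le_divisionField_holds fukuda1994_thm1_classNumberPExp_const_of_succ_eq_holds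
    hr classO6_g388800hw1_3 irr_g388800hw1_3 P 0 hram hord

/-! ### `388800hx1` @ `p = 3` — `N = 388800 = 2^6·3^5·5^2`; Cremona: `r_an = 0`; O6 wild at `3`; mod-`3` image `GL₂(𝔽₃)` (9-deficient tower; NO Cartan road); first road: the unit-twist record
`missingUpperBoundAt_g388800hx1_3` (k9-c4 g16/g17); kernel lemmas in `…WildUpperUnitTwistRecordsClassO618` (`classO6`) / `…WildUpperUnitTwistRecordsFlat47` (`irr`, `isElliptic`, `isGloballyMinimal`).  conjA-anchor g9 kit j296187
(`lp16.gp`): `k = ℚ(x(P)) = ℚ[x]/(x^4-6*x^2-7*x-3)` (`h = 1`), `K = ℚ(P) = ℚ[x]/(x^8+120*x^4-3160*x^2-1200)` (`h = 6`), `L_P = ℚ(P, ζ₃) = ℚ[x]/(x^16-120*x^12-1040*x^10+15600*x^8-81600*x^6+894400*x^4-2064000*x^2+1440000)` (degree 16): `h(L_P) = 12`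
(`Cl ≅ [6, 2]`, CERTIFIED), primes above `3`: `4[[6,1],[2,1],[2,1],[6,1]]`; octic leaves `O1:h=6:CERT;O2:h=2:CERT;O3:h=2:CERT;O1,1:h=6:GRH;O2,1:h=2:GRH;O3,1:h=2:GRH`; `layer0; #octics>k 3 of 3 octic subfields; v3h(L_P)+2v3h(k) 1; sum v3h(O_i) 1; KURODA-OK; octics certified 1; k cert CERT`; layer `(0,1)`: TOTRAM, `e₀(L_P) = 1`, `e₁(L_P) = 1` (Kuroda, GRH),
`r₀ = 1`, `r₁ = 1` ⟹ verdict FUKUDA1-LP(0,1). -/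

/-- **[NoF re-issue: the named facts `hLim`/`hF1`/`hF2`/`hCS` displayed by the original are DISCHARGED here by the tree theorems `…_holds` — read «modulo hLim/hF1/hF2/hCS» below as «no longer assumed».]** **(A) AT `(388800hx1, 3)` with the `μ`-hypothesis DISCHARGED by FUKUDA Thm. 1 (1) at layers `(0,1)` on `L_P = ℚ(E[3])^{U_P}`** (modulo the named facts
Lim 2017 Thm. 3.5 `hLim` and Fukuda `hF1`): `P` any geometric `3`-torsion point, displayed numerics on `L_P`: Fukuda index `0` (`hram`, exact: kit j296187 TOTRAM) and
`e₁(L_P) = e₀(L_P) = 1` (`hord`; `h(L_P) = 12` CERTIFIED, `e₁` by Kuroda from three degree-24 octic layers under GRH, kit j296187). CONDITIONAL; nothing booked;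
(A)/BSD proved for no curve. [cite: Lim2017FineSelmer, §3 Thm. 3.5 and Lemma 3.2 (arXiv:1306.2047 pp. 6–7)] [cite: Fukuda1994, Thm. 1 (1), p. 264] [cite: Cremona2006, Table 1 (Cremona label 388800hx1)] -/
theorem conjA_g388800hx1_3_lp01NoF
    {W : WeierstrassCurve ℚ} [W.IsElliptic] (hWeq : W = (⟨0, 0, 0, (-540), 4830⟩ : WeierstrassCurve ℚ)) (P : W.geomTorsion (3 : ℕ))
    (hram : ∀ κ : ZpExtension ↥(W.unipotentStabilizerField 3 P) 3, κ.IsCyclotomic → TotallyRamifiedFrom κ 0)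
    (hord : ∀ κ : ZpExtension ↥(W.unipotentStabilizerField 3 P) 3, κ.IsCyclotomic →
      classNumberPExp κ (0 + 1) = classNumberPExp κ 0)
    (κ : ZpExtension ℚ 3) (hκ : κ.IsCyclotomic) :
    ∃ (γ : absoluteGaloisGroup ℚ) (Df : W.FineSelmerDualData κ γ),
      Module.Finite ℤ_[3] (RestrictScalars ℤ_[3] (IwasawaAlgebra 3) Df.X) := by
  subst hWeq
  haveI : Fact (Nat.Prime 3) := ⟨Nat.prime_three⟩
  exact Lim2017.fineSelmerDual_moduleFinite_of_classNumberPExp_succ_eq_unipotentStabilizerField fukuda1994_thm1_classNumberPExp_const_of_succ_eq_holds Lim2017.thm35_fineSelmerDual_moduleFinite_of_classicalMuVanishes_of_le_divisionField_holds _ 3 (by decide) 0 P hram hord κ hκ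

/-- **[NoF re-issue: the named facts `hLim`/`hF1`/`hF2`/`hCS` displayed by the original are DISCHARGED here by the tree theorems `…_holds` — read «modulo hLim/hF1/hF2/hCS» below as «no longer assumed».]** **RECORD (second road) — U₀ `ord₃ #Ш(E) ≤ ord₃ #Ш_an(E)` for `E = 388800hx1` with the `μ`-hypothesis DISCHARGED by FUKUDA Thm. 1 (1) at layers `(0,1)` on `L_P`**: named facts
{A161-fine `hKatoA`, GZK `hGZK`, modularity `hmod`, `hLim`, `hF1`}, Cremona's `r_an = 0` (`hr`), a `3`-torsion point `P` and the displayed numerics `hram` / `hord` of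
`L_P = ℚ(E[3])^{U_P}` (evidence: conjA-anchor g9 kit j296187; GRH through the degree-24 octic layers only). KERNEL: `E` elliptic, minimal, `ClassO6 E 3`, `E[3]` irreducible.
Per row; nothing booked; BSD proved for no curve. [cite: Kato2004Asterisque, Thm. 14.5 (3) (p. 236)] [cite: Lim2017FineSelmer, §3 Thm. 3.5 and Lemma 3.2 (arXiv:1306.2047 pp. 6–7)]
[cite: Fukuda1994, Thm. 1 (1), p. 264] [cite: Cremona2006, Table 1 (Cremona label 388800hx1)] -/
theorem missingUpperBoundAt_g388800hx1_3_lp01NoF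
    (hKatoA : Kato2004.rankZero_padicValNat_sha_add_padicValNat_tamagawa_le_of_additive_potGood_of_irreducible_of_fineSelmerDual_fg)
    (hGZK : rank_eq_analyticRank_of_analyticRank_le_one) (hmod : hasEntireLFunction_rat)
    {W : WeierstrassCurve ℚ} [W.IsElliptic] [W.IsGloballyMinimal] (hWeq : W = (⟨0, 0, 0, (-540), 4830⟩ : WeierstrassCurve ℚ))
    (hr : W.analyticRank = 0) (P : W.geomTorsion (3 : ℕ))
    (hram : ∀ κ : ZpExtension ↥(W.unipotentStabilizerField 3 P) 3, κ.IsCyclotomic → TotallyRamifiedFrom κ 0)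
    (hord : ∀ κ : ZpExtension ↥(W.unipotentStabilizerField 3 P) 3, κ.IsCyclotomic →
      classNumberPExp κ (0 + 1) = classNumberPExp κ 0) :
    MissingUpperBoundAt W 3 := by
  subst hWeq
  haveI : Fact (Nat.Prime 3) := ⟨Nat.prime_three⟩
  exact UnitIndexMuDoors.missingUpperBoundAt_three_of_classNumberPExp_succ_eqAt_unipotentStabilizerField _ hKatoA hGZK hmod Lim2017.thm35_fineSelmerDual_moduleFinite_of_classicalMuVanishes_of_le_divisionField_holds fukuda1994_thm1_classNumberPExp_const_of_succ_eq_holds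
    hr classO6_g388800hx1_3 irr_g388800hx1_3 P 0 hram hord

/-! ### `388800ii1` @ `p = 3` — `N = 388800 = 2^6·3^5·5^2`; Cremona: `r_an = 0`; O6 wild at `3`; mod-`3` image `GL₂(𝔽₃)` (9-deficient tower; NO Cartan road); first road: the unit-twist record
`missingUpperBoundAt_g388800ii1_3` (k9-c4 g16/g17); kernel lemmas in `…WildConjAResidueCartanRows06` (`classO6`) / `…WildConjAResidueCartanRows06` (`irr`, `isElliptic`, `isGloballyMinimal`).  conjA-anchor g9 kit j296187
(`lp16.gp`): `k = ℚ(x(P)) = ℚ[x]/(x^4-6*x^2-7*x-3)` (`h = 1`), `K = ℚ(P) = ℚ[x]/(x^8-24*x^4-56*x^2-48)` (`h = 1`), `L_P = ℚ(P, ζ₃) = ℚ[x]/(x^16-8*x^15+36*x^14-112*x^13+290*x^12-504*x^11+240*x^10+1368*x^9-2757*x^8+136*x^7+5536*x^6-1464*x^5-6918*x^4+3120*x^3+10956*x^2+5416*x+793)` (degree 16): `h(L_P) = 2`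
(`Cl ≅ [2]`, CERTIFIED), primes above `3`: `2[[2,2],[6,2]]`; octic leaves `O1:h=1:CERT;O2:h=1:CERT;O3:h=2:CERT;O1,1:h=1:GRH;O2,1:h=1:GRH;O3,1:h=2:GRH`; `layer0; #octics>k 3 of 3 octic subfields; v3h(L_P)+2v3h(k) 0; sum v3h(O_i) 0; KURODA-OK; octics certified 1; k cert CERT`; layer `(0,1)`: TOTRAM, `e₀(L_P) = 0`, `e₁(L_P) = 0` (Kuroda, GRH),
`r₀ = 0`, `r₁ = 0` ⟹ verdict FUKUDA1-LP(0,1). -/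

/-- **[NoF re-issue: the named facts `hLim`/`hF1`/`hF2`/`hCS` displayed by the original are DISCHARGED here by the tree theorems `…_holds` — read «modulo hLim/hF1/hF2/hCS» below as «no longer assumed».]** **(A) AT `(388800ii1, 3)` with the `μ`-hypothesis DISCHARGED by FUKUDA Thm. 1 (1) at layers `(0,1)` on `L_P = ℚ(E[3])^{U_P}`** (modulo the named facts
Lim 2017 Thm. 3.5 `hLim` and Fukuda `hF1`): `P` any geometric `3`-torsion point, displayed numerics on `L_P`: Fukuda index `0` (`hram`, exact: kit j296187 TOTRAM) and
`e₁(L_P) = e₀(L_P) = 0` (`hord`; `h(L_P) = 2` CERTIFIED, `e₁` by Kuroda from three degree-24 octic layers under GRH, kit j296187). CONDITIONAL; nothing booked;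
(A)/BSD proved for no curve. [cite: Lim2017FineSelmer, §3 Thm. 3.5 and Lemma 3.2 (arXiv:1306.2047 pp. 6–7)] [cite: Fukuda1994, Thm. 1 (1), p. 264] [cite: Cremona2006, Table 1 (Cremona label 388800ii1)] -/
theorem conjA_g388800ii1_3_lp01NoF
    {W : WeierstrassCurve ℚ} [W.IsElliptic] (hWeq : W = (⟨0, 0, 0, (-13500), 603750⟩ : WeierstrassCurve ℚ)) (P : W.geomTorsion (3 : ℕ))
    (hram : ∀ κ : ZpExtension ↥(W.unipotentStabilizerField 3 P) 3, κ.IsCyclotomic → TotallyRamifiedFrom κ 0)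
    (hord : ∀ κ : ZpExtension ↥(W.unipotentStabilizerField 3 P) 3, κ.IsCyclotomic →
      classNumberPExp κ (0 + 1) = classNumberPExp κ 0)
    (κ : ZpExtension ℚ 3) (hκ : κ.IsCyclotomic) :
    ∃ (γ : absoluteGaloisGroup ℚ) (Df : W.FineSelmerDualData κ γ),
      Module.Finite ℤ_[3] (RestrictScalars ℤ_[3] (IwasawaAlgebra 3) Df.X) := by
  subst hWeq
  haveI : Fact (Nat.Prime 3) := ⟨Nat.prime_three⟩
  exact Lim2017.fineSelmerDual_moduleFinite_of_classNumberPExp_succ_eq_unipotentStabilizerField fukuda1994_thm1_classNumberPExp_const_of_succ_eq_holds Lim2017.thm35_fineSelmerDual_moduleFinite_of_classicalMuVanishes_of_le_divisionField_holds _ 3 (by decide) 0 P hram hord κ hκ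

/-- **[NoF re-issue: the named facts `hLim`/`hF1`/`hF2`/`hCS` displayed by the original are DISCHARGED here by the tree theorems `…_holds` — read «modulo hLim/hF1/hF2/hCS» below as «no longer assumed».]** **RECORD (second road) — U₀ `ord₃ #Ш(E) ≤ ord₃ #Ш_an(E)` for `E = 388800ii1` with the `μ`-hypothesis DISCHARGED by FUKUDA Thm. 1 (1) at layers `(0,1)` on `L_P`**: named facts
{A161-fine `hKatoA`, GZK `hGZK`, modularity `hmod`, `hLim`, `hF1`}, Cremona's `r_an = 0` (`hr`), a `3`-torsion point `P` and the displayed numerics `hram` / `hord` of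
`L_P = ℚ(E[3])^{U_P}` (evidence: conjA-anchor g9 kit j296187; GRH through the degree-24 octic layers only). KERNEL: `E` elliptic, minimal, `ClassO6 E 3`, `E[3]` irreducible.
Per row; nothing booked; BSD proved for no curve. [cite: Kato2004Asterisque, Thm. 14.5 (3) (p. 236)] [cite: Lim2017FineSelmer, §3 Thm. 3.5 and Lemma 3.2 (arXiv:1306.2047 pp. 6–7)]
[cite: Fukuda1994, Thm. 1 (1), p. 264] [cite: Cremona2006, Table 1 (Cremona label 388800ii1)] -/
theorem missingUpperBoundAt_g388800ii1_3_lp01NoF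
    (hKatoA : Kato2004.rankZero_padicValNat_sha_add_padicValNat_tamagawa_le_of_additive_potGood_of_irreducible_of_fineSelmerDual_fg)
    (hGZK : rank_eq_analyticRank_of_analyticRank_le_one) (hmod : hasEntireLFunction_rat)
    {W : WeierstrassCurve ℚ} [W.IsElliptic] [W.IsGloballyMinimal] (hWeq : W = (⟨0, 0, 0, (-13500), 603750⟩ : WeierstrassCurve ℚ))
    (hr : W.analyticRank = 0) (P : W.geomTorsion (3 : ℕ))
    (hram : ∀ κ : ZpExtension ↥(W.unipotentStabilizerField 3 P) 3, κ.IsCyclotomic → TotallyRamifiedFrom κ 0)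
    (hord : ∀ κ : ZpExtension ↥(W.unipotentStabilizerField 3 P) 3, κ.IsCyclotomic →
      classNumberPExp κ (0 + 1) = classNumberPExp κ 0) :
    MissingUpperBoundAt W 3 := by
  subst hWeq
  haveI : Fact (Nat.Prime 3) := ⟨Nat.prime_three⟩
  exact UnitIndexMuDoors.missingUpperBoundAt_three_of_classNumberPExp_succ_eqAt_unipotentStabilizerField _ hKatoA hGZK hmod Lim2017.thm35_fineSelmerDual_moduleFinite_of_classicalMuVanishes_of_le_divisionField_holds fukuda1994_thm1_classNumberPExp_const_of_succ_eq_holds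
    hr classO6_g388800ii1_3 irr_g388800ii1_3 P 0 hram hord

/-! ### `388800ol1` @ `p = 3` — `N = 388800 = 2^6·3^5·5^2`; Cremona: `r_an = 0`; O6 wild at `3`; mod-`3` image `GL₂(𝔽₃)` (9-deficient tower; NO Cartan road); first road: the unit-twist record
`missingUpperBoundAt_g388800ol1_3` (k9-c4 g16/g17); kernel lemmas in `…WildUpperUnitTwistRecordsClassO618` (`classO6`) / `…WildUpperUnitTwistRecordsFlat48` (`irr`, `isElliptic`, `isGloballyMinimal`).  conjA-anchor g9 kit j296187
(`lp16.gp`): `k = ℚ(x(P)) = ℚ[x]/(x^4-2*x^3-4*x+2)` (`h = 1`), `K = ℚ(P) = ℚ[x]/(x^8-4*x^7+4*x^6+52*x^5-370*x^4+892*x^3+996*x^2-11436*x+13389)` (`h = 2`), `L_P = ℚ(P, ζ₃) = ℚ[x]/(x^16-8*x^15+58*x^14-364*x^13+2684*x^12-18628*x^11+117292*x^10-612008*x^9+2409286*x^8-6972048*x^7+14772168*x^6-22617552*x^5+24417048*x^4-17914272*x^3+8426640*x^2-2281680*x+271764)` (degree 16): `h(L_P) = 4`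
(`Cl ≅ [2, 2]`, CERTIFIED), primes above `3`: `4[[6,1],[2,1],[2,1],[6,1]]`; octic leaves `O1:h=2:CERT;O2:h=2:CERT;O3:h=2:CERT;O1,1:h=2:GRH;O2,1:h=2:GRH;O3,1:h=2:GRH`; `layer0; #octics>k 3 of 3 octic subfields; v3h(L_P)+2v3h(k) 0; sum v3h(O_i) 0; KURODA-OK; octics certified 1; k cert CERT`; layer `(0,1)`: TOTRAM, `e₀(L_P) = 0`, `e₁(L_P) = 0` (Kuroda, GRH),
`r₀ = 0`, `r₁ = 0` ⟹ verdict FUKUDA1-LP(0,1). -/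

/-- **[NoF re-issue: the named facts `hLim`/`hF1`/`hF2`/`hCS` displayed by the original are DISCHARGED here by the tree theorems `…_holds` — read «modulo hLim/hF1/hF2/hCS» below as «no longer assumed».]** **(A) AT `(388800ol1, 3)` with the `μ`-hypothesis DISCHARGED by FUKUDA Thm. 1 (1) at layers `(0,1)` on `L_P = ℚ(E[3])^{U_P}`** (modulo the named facts
Lim 2017 Thm. 3.5 `hLim` and Fukuda `hF1`): `P` any geometric `3`-torsion point, displayed numerics on `L_P`: Fukuda index `0` (`hram`, exact: kit j296187 TOTRAM) and
`e₁(L_P) = e₀(L_P) = 0` (`hord`; `h(L_P) = 4` CERTIFIED, `e₁` by Kuroda from three degree-24 octic layers under GRH, kit j296187). CONDITIONAL; nothing booked;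
(A)/BSD proved for no curve. [cite: Lim2017FineSelmer, §3 Thm. 3.5 and Lemma 3.2 (arXiv:1306.2047 pp. 6–7)] [cite: Fukuda1994, Thm. 1 (1), p. 264] [cite: Cremona2006, Table 1 (Cremona label 388800ol1)] -/
theorem conjA_g388800ol1_3_lp01NoF
    {W : WeierstrassCurve ℚ} [W.IsElliptic] (hWeq : W = (⟨0, 0, 0, (-4884300), (-4154814000)⟩ : WeierstrassCurve ℚ)) (P : W.geomTorsion (3 : ℕ))
    (hram : ∀ κ : ZpExtension ↥(W.unipotentStabilizerField 3 P) 3, κ.IsCyclotomic → TotallyRamifiedFrom κ 0)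
    (hord : ∀ κ : ZpExtension ↥(W.unipotentStabilizerField 3 P) 3, κ.IsCyclotomic →
      classNumberPExp κ (0 + 1) = classNumberPExp κ 0)
    (κ : ZpExtension ℚ 3) (hκ : κ.IsCyclotomic) :
    ∃ (γ : absoluteGaloisGroup ℚ) (Df : W.FineSelmerDualData κ γ),
      Module.Finite ℤ_[3] (RestrictScalars ℤ_[3] (IwasawaAlgebra 3) Df.X) := by
  subst hWeq
  haveI : Fact (Nat.Prime 3) := ⟨Nat.prime_three⟩
  exact Lim2017.fineSelmerDual_moduleFinite_of_classNumberPExp_succ_eq_unipotentStabilizerField fukuda1994_thm1_classNumberPExp_const_of_succ_eq_holds Lim2017.thm35_fineSelmerDual_moduleFinite_of_classicalMuVanishes_of_le_divisionField_holds _ 3 (by decide) 0 P hram hord κ hκ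

/-- **[NoF re-issue: the named facts `hLim`/`hF1`/`hF2`/`hCS` displayed by the original are DISCHARGED here by the tree theorems `…_holds` — read «modulo hLim/hF1/hF2/hCS» below as «no longer assumed».]** **RECORD (second road) — U₀ `ord₃ #Ш(E) ≤ ord₃ #Ш_an(E)` for `E = 388800ol1` with the `μ`-hypothesis DISCHARGED by FUKUDA Thm. 1 (1) at layers `(0,1)` on `L_P`**: named facts
{A161-fine `hKatoA`, GZK `hGZK`, modularity `hmod`, `hLim`, `hF1`}, Cremona's `r_an = 0` (`hr`), a `3`-torsion point `P` and the displayed numerics `hram` / `hord` of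
`L_P = ℚ(E[3])^{U_P}` (evidence: conjA-anchor g9 kit j296187; GRH through the degree-24 octic layers only). KERNEL: `E` elliptic, minimal, `ClassO6 E 3`, `E[3]` irreducible.
Per row; nothing booked; BSD proved for no curve. [cite: Kato2004Asterisque, Thm. 14.5 (3) (p. 236)] [cite: Lim2017FineSelmer, §3 Thm. 3.5 and Lemma 3.2 (arXiv:1306.2047 pp. 6–7)]
[cite: Fukuda1994, Thm. 1 (1), p. 264] [cite: Cremona2006, Table 1 (Cremona label 388800ol1)] -/
theorem missingUpperBoundAt_g388800ol1_3_lp01NoF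
    (hKatoA : Kato2004.rankZero_padicValNat_sha_add_padicValNat_tamagawa_le_of_additive_potGood_of_irreducible_of_fineSelmerDual_fg)
    (hGZK : rank_eq_analyticRank_of_analyticRank_le_one) (hmod : hasEntireLFunction_rat)
    {W : WeierstrassCurve ℚ} [W.IsElliptic] [W.IsGloballyMinimal] (hWeq : W = (⟨0, 0, 0, (-4884300), (-4154814000)⟩ : WeierstrassCurve ℚ))
    (hr : W.analyticRank = 0) (P : W.geomTorsion (3 : ℕ))
    (hram : ∀ κ : ZpExtension ↥(W.unipotentStabilizerField 3 P) 3, κ.IsCyclotomic → TotallyRamifiedFrom κ 0)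
    (hord : ∀ κ : ZpExtension ↥(W.unipotentStabilizerField 3 P) 3, κ.IsCyclotomic →
      classNumberPExp κ (0 + 1) = classNumberPExp κ 0) :
    MissingUpperBoundAt W 3 := by
  subst hWeq
  haveI : Fact (Nat.Prime 3) := ⟨Nat.prime_three⟩
  exact UnitIndexMuDoors.missingUpperBoundAt_three_of_classNumberPExp_succ_eqAt_unipotentStabilizerField _ hKatoA hGZK hmod Lim2017.thm35_fineSelmerDual_moduleFinite_of_classicalMuVanishes_of_le_divisionField_holds fukuda1994_thm1_classNumberPExp_const_of_succ_eq_holds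
    hr classO6_g388800ol1_3 irr_g388800ol1_3 P 0 hram hord

end Summit.BirchSwinnertonDyer.BirchSwinnertonDyer.Theorems.WildUpperUnitTwistRecords

end
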